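import Summits.QuantumFields.QCD.Theorems.HeatSlicedQuarksQuarkLoopCoefficientSecondOrderCoefficientAux
import Summits.QuantumFields.QCD.Theorems.HeatSlicedQuarksQuarkLoopCoefficientSecondOrderExpansionAux

/-!
# Quark-loop coefficient, stub `secondOrderCoefficient`, part B: the first Moyal cancellation and the traces

Helper file of the line `Sketch` of crux stmt-QuantumFields-16786 (stub `stub_secondOrderCoefficient`:
`e2 t → 1/(12π²)` at rate `C/t`).  Given the structural facts of the free kernel `k_t = freeKer t`
(conjuncts of the line's `FreeHeatCalculus`, hypotheses here: the scalar `D♯D` symbol, `k_0 = δ`, the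
semigroup law, the IBP identity `t Σ_z z_ν ĥ(z) k_t(w−z) + w_ν k_t(w) = 0`), this file proves:

* the first Moyal cancellation `Σ_v (v∧y) ĥ(v) k_r(y − v) = 0`;
* `vtx 1 (k_r·1) = Σ_v k_r(· − v) η(v)` with the first-order vertex `η(v) = Σ_z (i/2)(z∧v) ď♯(z)ď(v−z)`,
  and the first-order term `pert1 s w = −s Σ_v k_s(w−v) η(v)` (the `r`-integrand is constant by the
  semigroup law);
* the two second-order traces `tr[vtx 2 (k_s·1)(w)]`, `tr[vtx 1 (pert1 s)(w)]` as finite combinations of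
  shifted free kernels with polynomial weights `(z∧v + v∧w)²`, `v∧w`.

Mathlib + the Defs file + part A (`…SecondOrderCoefficientAux`) + the sibling `…SecondOrderExpansionAux` (wedge algebra).
-/

noncomputable section

namespace Summit.QuantumFields.QCD.Cruxes.QuarkLoopCoefficient.Sketch.SecondOrderCoefficient

open Literature.MathematicalPhysics.QuantumLattice Literature.MathematicalPhysics.QuantumFieldTheory
open Literature.Probability.LatticeModels (Site)
open Summit.QuantumFields.QCD.Theorems.QuarkLoopCoefficient
open Summit.QuantumFields.QCD.Cruxes.QuarkLoopCoefficient.Sketch.HeatSeries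
open scoped Matrix ComplexConjugate

attribute [local irreducible] nbr nbr2

/-! ## The first Moyal cancellation -/

/-- The first Moyal cancellation: `Σ_{v ∈ nbr2 0} (v∧y) ĥ(v) k_r(y − v) = 0` for `r ≥ 0` (from the IBP
identity `r·Σ_v v_ν ĥ(v) k_r(y−v) = −y_ν k_r(y)` and `v∧y = v₀y₁ − v₁y₀`; at `r = 0` from `k_0 = δ`). -/
theorem moyal_sum_eq_zero
    (hδ : ∀ w : Site 4, freeKer 0 w = if w = 0 then 1 else 0)
    (hibp : ∀ t : ℝ, 0 ≤ t → ∀ (w : Site 4) (ν : Fin 4),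
      t * (∑ z ∈ nbr2 0, ((z ν : ℤ) : ℝ) * hhat z * freeKer t (w - z)) + ((w ν : ℤ) : ℝ) * freeKer t w = 0)
    {r : ℝ} (hr : 0 ≤ r) (y : Site 4) :
    ∑ v ∈ nbr2 0, ((wedge v y : ℤ) : ℝ) * hhat v * freeKer r (y - v) = 0 := by
  have hsplit : ∑ v ∈ nbr2 0, ((wedge v y : ℤ) : ℝ) * hhat v * freeKer r (y - v) =
      ((y 1 : ℤ) : ℝ) * ∑ v ∈ nbr2 0, ((v 0 : ℤ) : ℝ) * hhat v * freeKer r (y - v) -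
        ((y 0 : ℤ) : ℝ) * ∑ v ∈ nbr2 0, ((v 1 : ℤ) : ℝ) * hhat v * freeKer r (y - v) := by
    rw [Finset.mul_sum, Finset.mul_sum, ← Finset.sum_sub_distrib]
    refine Finset.sum_congr rfl fun v _ => ?_
    unfold wedge; push_cast; ring
  rw [hsplit]
  rcases hr.eq_or_lt with h | h
  · subst h
    simp only [hδ, sub_eq_zero, mul_ite, mul_one, mul_zero, Finset.sum_ite_eq]
    split_ifs <;> ring
  · have h0 := hibp r hr y 0
    have h1 := hibp r hr y 1
    have key : r * (((y 1 : ℤ) : ℝ) * ∑ v ∈ nbr2 0, ((v 0 : ℤ) : ℝ) * hhat v * freeKer r (y - v) -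
        ((y 0 : ℤ) : ℝ) * ∑ v ∈ nbr2 0, ((v 1 : ℤ) : ℝ) * hhat v * freeKer r (y - v)) = 0 := by
      linear_combination ((y 1 : ℤ) : ℝ) * h0 - ((y 0 : ℤ) : ℝ) * h1
    exact (mul_eq_zero.mp key).resolve_left h.ne'

/-! ## The first-order vertex on the free kernel and the first-order term -/

/-- `vtx 1 (k_r·1)(y) = Σ_v k_r(y − v) η(v)` with the first-order vertex
`η(v) = Σ_{z ∈ nbr 0} (i/2)(z∧v) ď♯(z)ď(v−z)`: the `v∧y` part of the phase drops out by the first Moyal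
cancellation (the free `D♯D` symbol being scalar). -/
theorem vtx_one_pert0
    (hsq : ∀ x y : Site 4, sqKer (fun _ => (1 : ℂ)) x y = ((hhat (y - x) : ℝ) : ℂ) • (1 : Spin))
    (hδ : ∀ w : Site 4, freeKer 0 w = if w = 0 then 1 else 0)
    (hibp : ∀ t : ℝ, 0 ≤ t → ∀ (w : Site 4) (ν : Fin 4),
      t * (∑ z ∈ nbr2 0, ((z ν : ℤ) : ℝ) * hhat z * freeKer t (w - z)) + ((w ν : ℤ) : ℝ) * freeKer t w = 0)
    {r : ℝ} (hr : 0 ≤ r) (y : Site 4) :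
    vtx 1 (pert0 r) y = ∑ v ∈ nbr2 0, ((freeKer r (y - v) : ℝ) : ℂ) •
      ∑ z ∈ nbr 0, (Complex.I / 2 * ((wedge z v : ℤ) : ℂ)) • (dsharp z * dsymb (v - z)) := by
  unfold vtx pert0
  simp only [pow_one, Nat.factorial_one, Nat.cast_one, div_one]
  calc ∑ v ∈ nbr2 0, ∑ z ∈ nbr 0, (Complex.I / 2 * ((wedge z v + wedge v y : ℤ) : ℂ)) •
        (dsharp z * dsymb (v - z) * (((freeKer r (y - v) : ℝ) : ℂ) • (1 : Spin)))
      = ∑ v ∈ nbr2 0, ∑ z ∈ nbr 0,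
          ((((freeKer r (y - v) : ℝ) : ℂ)) • ((Complex.I / 2 * ((wedge z v : ℤ) : ℂ)) •
              (dsharp z * dsymb (v - z))) +
            (Complex.I / 2 * (((wedge v y : ℤ) : ℝ) * freeKer r (y - v) : ℝ)) • (dsharp z * dsymb (v - z))) := by
        refine Finset.sum_congr rfl fun v _ => Finset.sum_congr rfl fun z _ => ?_
        rw [Matrix.mul_smul, Matrix.mul_one, smul_smul, smul_smul, ← add_smul]
        congr 1
        push_cast
        ring
    _ = ∑ v ∈ nbr2 0, ((freeKer r (y - v) : ℝ) : ℂ) •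
          ∑ z ∈ nbr 0, (Complex.I / 2 * ((wedge z v : ℤ) : ℂ)) • (dsharp z * dsymb (v - z)) +
        (Complex.I / 2 * ((∑ v ∈ nbr2 0, ((wedge v y : ℤ) : ℝ) * hhat v * freeKer r (y - v) : ℝ) : ℂ)) •
          (1 : Spin) := by
        simp only [Finset.sum_add_distrib, Finset.smul_sum]
        congr 1
        calc ∑ v ∈ nbr2 0, ∑ z ∈ nbr 0,
              (Complex.I / 2 * (((wedge v y : ℤ) : ℝ) * freeKer r (y - v) : ℝ)) • (dsharp z * dsymb (v - z))
            = ∑ v ∈ nbr2 0, (Complex.I / 2 * (((wedge v y : ℤ) : ℝ) * freeKer r (y - v) : ℝ) *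
                ((hhat v : ℝ) : ℂ)) • (1 : Spin) := by
              refine Finset.sum_congr rfl fun v _ => ?_
              rw [← Finset.smul_sum, sum_dsharp_mul_dsymb hsq v, smul_smul]
          _ = _ := by
              rw [← Finset.sum_smul]
              congr 1
              push_cast
              rw [Finset.mul_sum]
              refine Finset.sum_congr rfl fun v _ => ?_
              ring
    _ = _ := by rw [moyal_sum_eq_zero hδ hibp hr y, Complex.ofReal_zero, mul_zero, zero_smul, add_zero]

/-- The first-order term is `E₁(s) = −s·(η ∗ k_s)`:
`pert1 s w = −s Σ_v k_s(w − v) η(v)` for `s ≥ 0` (the `r`-integrand `k_{s−r} ∗ η ∗ k_r = η ∗ k_s` is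
constant by the semigroup law). -/
theorem pert1_eq
    (hsq : ∀ x y : Site 4, sqKer (fun _ => (1 : ℂ)) x y = ((hhat (y - x) : ℝ) : ℂ) • (1 : Spin))
    (hδ : ∀ w : Site 4, freeKer 0 w = if w = 0 then 1 else 0)
    (hsemi : ∀ s r : ℝ, 0 ≤ s → 0 ≤ r → ∀ w : Site 4,
      HasSum (fun y : Site 4 => freeKer s y * freeKer r (w - y)) (freeKer (s + r) w))
    (hibp : ∀ t : ℝ, 0 ≤ t → ∀ (w : Site 4) (ν : Fin 4),
      t * (∑ z ∈ nbr2 0, ((z ν : ℤ) : ℝ) * hhat z * freeKer t (w - z)) + ((w ν : ℤ) : ℝ) * freeKer t w = 0)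
    {s : ℝ} (hs : 0 ≤ s) (w : Site 4) :
    pert1 s w = -((s : ℂ) • ∑ v ∈ nbr2 0, ((freeKer s (w - v) : ℝ) : ℂ) •
      ∑ z ∈ nbr 0, (Complex.I / 2 * ((wedge z v : ℤ) : ℂ)) • (dsharp z * dsymb (v - z))) := by
  have hconv : ∀ r ∈ Set.uIcc 0 s, freeConv (s - r) (vtx 1 (pert0 r)) w =
      ∑ v ∈ nbr2 0, ((freeKer s (w - v) : ℝ) : ℂ) •
        ∑ z ∈ nbr 0, (Complex.I / 2 * ((wedge z v : ℤ) : ℂ)) • (dsharp z * dsymb (v - z)) := by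
    intro r hr
    rw [Set.uIcc_of_le hs] at hr
    obtain ⟨hr0, hrs⟩ := hr
    unfold freeConv
    simp only [vtx_one_pert0 hsq hδ hibp hr0]
    refine HasSum.tsum_eq ?_
    have hfun : (fun y : Site 4 => ((freeKer (s - r) (w - y) : ℝ) : ℂ) • ∑ v ∈ nbr2 0, ((freeKer r (y - v) : ℝ) : ℂ) •
        ∑ z ∈ nbr 0, (Complex.I / 2 * ((wedge z v : ℤ) : ℂ)) • (dsharp z * dsymb (v - z))) =
        fun y : Site 4 => ∑ v ∈ nbr2 0, ((freeKer (s - r) (w - y) * freeKer r (y - v) : ℝ) : ℂ) •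
          ∑ z ∈ nbr 0, (Complex.I / 2 * ((wedge z v : ℤ) : ℂ)) • (dsharp z * dsymb (v - z)) := by
      ext y
      rw [Finset.smul_sum]
      simp only [smul_smul, Complex.ofReal_mul]
    rw [hfun]
    refine hasSum_sum fun v _ => ?_
    have h := hsemi (s - r) r (sub_nonneg.mpr hrs) hr0 (w - v)
    rw [sub_add_cancel] at h
    have h2 : HasSum (fun y : Site 4 => freeKer (s - r) (w - y) * freeKer r (y - v)) (freeKer s (w - v)) := by
      have h3 := (Equiv.subLeft w).hasSum_iff.mpr h
      convert h3 using 1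
      ext y
      simp only [Function.comp_apply, Equiv.subLeft_apply, sub_sub_sub_cancel_left]
    exact (Complex.hasSum_ofReal.mpr h2).smul_const _
  unfold pert1
  ext α β
  rw [Matrix.of_apply, intervalIntegral.integral_congr (fun r hr => by rw [hconv r hr]),
    intervalIntegral.integral_const, sub_zero, Matrix.neg_apply, Matrix.smul_apply, Complex.real_smul,
    smul_eq_mul]

/-! ## The two second-order traces -/

/-- `tr[vtx 2 (k_s·1)(w)] = Σ_{v,z} −(z∧v + v∧w)²/8 · k_s(w − v) · tr[ď♯(z)ď(v−z)]`. -/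
theorem trace_vtx_two_pert0 (s : ℝ) (w : Site 4) :
    (vtx 2 (pert0 s) w).trace = ∑ v ∈ nbr2 0, ∑ z ∈ nbr 0,
      -(((wedge z v + wedge v w : ℤ) : ℂ) ^ 2 / 8) * ((freeKer s (w - v) : ℝ) : ℂ) *
        (dsharp z * dsymb (v - z)).trace := by
  unfold vtx pert0
  rw [Matrix.trace_sum]
  refine Finset.sum_congr rfl fun v _ => ?_
  rw [Matrix.trace_sum]
  refine Finset.sum_congr rfl fun z _ => ?_
  rw [Matrix.mul_smul, Matrix.mul_one, Matrix.trace_smul, Matrix.trace_smul, smul_eq_mul, smul_eq_mul,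
    Nat.factorial_two, Nat.cast_ofNat, mul_pow, div_pow, Complex.I_sq]
  ring

/-- `tr[vtx 1 (E₁(s))(w)] = −s Σ_{v,v'} k_s(w − v − v') { tr[η(v)η(v')] + (i/2)(v∧w) ĥ(v) tr η(v') }`
for `s ≥ 0`. -/
theorem trace_vtx_one_pert1
    (hsq : ∀ x y : Site 4, sqKer (fun _ => (1 : ℂ)) x y = ((hhat (y - x) : ℝ) : ℂ) • (1 : Spin))
    (hδ : ∀ w : Site 4, freeKer 0 w = if w = 0 then 1 else 0)
    (hsemi : ∀ s r : ℝ, 0 ≤ s → 0 ≤ r → ∀ w : Site 4,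
      HasSum (fun y : Site 4 => freeKer s y * freeKer r (w - y)) (freeKer (s + r) w))
    (hibp : ∀ t : ℝ, 0 ≤ t → ∀ (w : Site 4) (ν : Fin 4),
      t * (∑ z ∈ nbr2 0, ((z ν : ℤ) : ℝ) * hhat z * freeKer t (w - z)) + ((w ν : ℤ) : ℝ) * freeKer t w = 0)
    {s : ℝ} (hs : 0 ≤ s) (w : Site 4) :
    (vtx 1 (pert1 s) w).trace = -(s : ℂ) * ∑ v ∈ nbr2 0, ∑ v' ∈ nbr2 0,
      ((freeKer s (w - v - v') : ℝ) : ℂ) *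
        (((∑ z ∈ nbr 0, (Complex.I / 2 * ((wedge z v : ℤ) : ℂ)) • (dsharp z * dsymb (v - z))) *
            (∑ z ∈ nbr 0, (Complex.I / 2 * ((wedge z v' : ℤ) : ℂ)) • (dsharp z * dsymb (v' - z)))).trace +
          Complex.I / 2 * ((wedge v w : ℤ) : ℂ) * ((hhat v : ℝ) : ℂ) *
            (∑ z ∈ nbr 0, (Complex.I / 2 * ((wedge z v' : ℤ) : ℂ)) • (dsharp z * dsymb (v' - z))).trace) := by
  unfold vtx
  simp only [pow_one, Nat.factorial_one, Nat.cast_one, div_one, pert1_eq hsq hδ hsemi hibp hs]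
  rw [Matrix.trace_sum, Finset.mul_sum]
  refine Finset.sum_congr rfl fun v _ => ?_
  -- push the trace through and collect the scalar factors
  have hlin : ∀ z : Site 4, ((Complex.I / 2 * ((wedge z v + wedge v w : ℤ) : ℂ)) •
      (dsharp z * dsymb (v - z) * -((s : ℂ) • ∑ v' ∈ nbr2 0, ((freeKer s (w - v - v') : ℝ) : ℂ) •
        ∑ z' ∈ nbr 0, (Complex.I / 2 * ((wedge z' v' : ℤ) : ℂ)) • (dsharp z' * dsymb (v' - z'))))).trace =
      ∑ v' ∈ nbr2 0, (-(s : ℂ) * ((freeKer s (w - v - v') : ℝ) : ℂ)) *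
        ((Complex.I / 2 * ((wedge z v : ℤ) : ℂ)) * (dsharp z * dsymb (v - z) *
            ∑ z' ∈ nbr 0, (Complex.I / 2 * ((wedge z' v' : ℤ) : ℂ)) • (dsharp z' * dsymb (v' - z'))).trace +
          (Complex.I / 2 * ((wedge v w : ℤ) : ℂ)) * (dsharp z * dsymb (v - z) *
            ∑ z' ∈ nbr 0, (Complex.I / 2 * ((wedge z' v' : ℤ) : ℂ)) • (dsharp z' * dsymb (v' - z'))).trace) := by
    intro z
    rw [Matrix.trace_smul, smul_eq_mul, Matrix.mul_neg, Matrix.trace_neg, Matrix.mul_smul, Matrix.trace_smul,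
      smul_eq_mul, Finset.mul_sum, Matrix.trace_sum]
    simp only [Matrix.mul_smul, Matrix.trace_smul, smul_eq_mul]
    rw [Finset.mul_sum, mul_neg, Finset.mul_sum, ← Finset.sum_neg_distrib]
    refine Finset.sum_congr rfl fun v' _ => ?_
    push_cast
    ring
  rw [Matrix.trace_sum, Finset.sum_congr rfl fun z _ => hlin z]
  rw [Finset.sum_comm, Finset.mul_sum]
  refine Finset.sum_congr rfl fun v' _ => ?_
  rw [← Finset.mul_sum, mul_assoc]
  congr 2
  rw [Finset.sum_add_distrib]
  congr 1
  · rw [Finset.sum_mul, Matrix.trace_sum]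
    refine Finset.sum_congr rfl fun z _ => ?_
    rw [Matrix.smul_mul, Matrix.trace_smul, smul_eq_mul]
  · rw [← Finset.mul_sum, ← Matrix.trace_sum, ← Finset.sum_mul, sum_dsharp_mul_dsymb hsq v, Matrix.smul_mul,
      Matrix.one_mul, Matrix.trace_smul, smul_eq_mul, ← mul_assoc]

/-! ## Registered headline -/

/-- Registered headline of this helper file (aux stub `stub_secondOrderCoefficientAuxB` of crux
stmt-QuantumFields-16786, line `Sketch`): the trace of the second-order vertex on the free kernel. -/
theorem stub_secondOrderCoefficientAuxB :
    ∀ (s : ℝ) (w : Site 4), (vtx 2 (pert0 s) w).trace = ∑ v ∈ nbr2 0, ∑ z ∈ nbr 0,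
      -(((wedge z v + wedge v w : ℤ) : ℂ) ^ 2 / 8) * ((freeKer s (w - v) : ℝ) : ℂ) * (dsharp z * dsymb (v - z)).trace :=
  fun s w => trace_vtx_two_pert0 s w

end Summit.QuantumFields.QCD.Cruxes.QuarkLoopCoefficient.Sketch.SecondOrderCoefficient

end
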